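import Literature.Analysis.Calculus.CkArzelaAscoli
import Literature.Geometry.Lorentzian.SpacetimeMetricInCoordsCalculus
import HarnessLib

/-!
# `Cᵏ` compactness of uniformly `C^{k+1}`-bounded fields of bilinear forms (metric components)
(topic `Geometry/Lorentzian`; the per-chart analytic half of Cheeger–Gromov–Anderson compactness
in the `supCkENorm` vocabulary of `KerrConvergence.lean` / `SpacetimeLocalConvergence.lean`;
Petersen 2006, Ch. 10, §3.1 and Thm. 72; Anderson 2004, §5)

**Theorem (`exists_strictMono_tendsto_supCkENorm_sub`).** Let `Gₙ : E → (E →L E →L ℝ)` be fields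
of continuous bilinear forms (e.g. metric components `metricInCoords ψₙ` of charts of spacetimes)
of class `C^{k+1}` on an open set `O` of a finite-dimensional space `E`, with a common bound
`‖Dⁱ Gₙ‖ ≤ Λ_K` on every compact `K ⊆ O` for all `i ≤ k + 1` (`…_of_bound`: one bound on `O`). Then along a subsequence `φ` the fields converge in
`Cᵏ` on every compact `K ⊆ O` to a field `G` of class `Cᵏ` on `O`:
`supCkENorm K k (G_{φ n} − G) → 0`.

This is the compactness that a PRODUCER of pointed `Cᵏ_loc` limits (`SubconvergesLocallyTo`) needs
chart by chart; it is a direct translation of the `Cᵏ` Arzelà–Ascoli theorem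
(`Literature/Analysis/Calculus/CkArzelaAscoli.lean`). What it does NOT provide is the gluing of the
chart limits into a limit manifold, nor smoothness of the limit beyond `Cᵏ` (a `Cᵏ_loc` limit of
smooth metrics is in general only `Cᵏ`).

## References
* [Petersen2006] P. Petersen, *Riemannian Geometry*, 2nd ed., GTM 171, Springer 2006, Ch. 10.
* [Anderson2004] M. T. Anderson, *Cheeger–Gromov theory and applications to general relativity*,
  in: The Einstein Equations and the Large Scale Behavior of Gravitational Fields, Birkhäuser 2004, §5.
-/

noncomputable section

open Set Metric Filter Topology Function Manifold
open scoped ContDiff Topology ENNReal Manifold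

namespace Literature.Geometry.Lorentzian

open Literature.Analysis.Calculus

variable {E : Type*} [NormedAddCommGroup E] [NormedSpace ℝ E] [FiniteDimensional ℝ E]
  {W : Type*} [NormedAddCommGroup W] [NormedSpace ℝ W] [FiniteDimensional ℝ W]

/-- **`Cᵏ` compactness of uniformly `C^{k+1}`-bounded sequences, `supCkENorm` form.** For maps
`Gₙ : E → W` (`W` finite-dimensional, e.g. `E →L E →L ℝ`) of class `C^{k+1}` on an open `O` with a
common bound on all derivatives of order `≤ k + 1` on each compact subset of `O`, a subsequence converges in `Cᵏ` on
every compact subset of `O` to a `Cᵏ` map: `supCkENorm K k (G_{φ n} − G) → 0`. [cite: Petersen2006, Ch. 10 §3.1] -/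
theorem exists_strictMono_tendsto_supCkENorm_sub {O : Set E} (hO : IsOpen O) {k : ℕ}
    {G : ℕ → E → W} (hG : ∀ n, ContDiffOn ℝ (k + 1) (G n) O)
    (hb : ∀ K ⊆ O, IsCompact K →
      ∃ Λ : ℝ, ∀ n, ∀ i, i ≤ k + 1 → ∀ z ∈ K, ‖iteratedFDeriv ℝ i (G n) z‖ ≤ Λ) :
    ∃ (Glim : E → W) (φ : ℕ → ℕ), StrictMono φ ∧ ContDiffOn ℝ k Glim O ∧
      ∀ K ⊆ O, IsCompact K →
        Tendsto (fun n ↦ supCkENorm K k (G (φ n) - Glim)) atTop (𝓝 0) := by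
  obtain ⟨Glim, φ, hφ, hgk, hev⟩ :=
    exists_strictMono_contDiffOn_eventually_norm_iteratedFDeriv_sub_lt hO hG hb
  refine ⟨Glim, φ, hφ, hgk, fun K hKO hK ↦ ?_⟩
  rw [ENNReal.tendsto_nhds_zero]
  intro ε hε
  rcases eq_top_or_lt_top ε with rfl | hεtop
  · exact Eventually.of_forall fun _ ↦ le_top
  have hεr : 0 < ε.toReal := ENNReal.toReal_pos hε.ne' hεtop.ne
  filter_upwards [hev K hKO hK ε.toReal hεr] with n hn
  rw [← ENNReal.ofReal_toReal hεtop.ne]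
  refine supCkENorm_le_ofReal fun m hm x hx ↦ ?_
  have hGn : ContDiffAt ℝ m (G (φ n)) x :=
    (((hG (φ n)).of_le (by exact_mod_cast Nat.le_succ_of_le hm)).contDiffAt (hO.mem_nhds (hKO hx)))
  have hGlim : ContDiffAt ℝ m Glim x :=
    ((hgk.of_le (by exact_mod_cast hm)).contDiffAt (hO.mem_nhds (hKO hx)))
  rw [iteratedFDeriv_sub_apply hGn hGlim]
  exact (hn m hm x hx).le

/-- **`Cᵏ` compactness from ONE bound on the open set** (e.g. `supCkENorm O (k+1) Gₙ ≤ Λ` for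
chart balls of tame spacetimes). [cite: Petersen2006, Ch. 10 §3.1] -/
theorem exists_strictMono_tendsto_supCkENorm_sub_of_bound {O : Set E} (hO : IsOpen O) {k : ℕ}
    {G : ℕ → E → W} (hG : ∀ n, ContDiffOn ℝ (k + 1) (G n) O) {Λ : ℝ}
    (hΛ : ∀ n, ∀ i, i ≤ k + 1 → ∀ z ∈ O, ‖iteratedFDeriv ℝ i (G n) z‖ ≤ Λ) :
    ∃ (Glim : E → W) (φ : ℕ → ℕ), StrictMono φ ∧ ContDiffOn ℝ k Glim O ∧
      ∀ K ⊆ O, IsCompact K →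
        Tendsto (fun n ↦ supCkENorm K k (G (φ n) - Glim)) atTop (𝓝 0) :=
  exists_strictMono_tendsto_supCkENorm_sub hO hG (locallyBounded_iteratedFDeriv_of_bound hΛ)

/-- The same with the uniform bound given through `supCkENorm` over the open set (a finite
`C^{k+1}` sup norm on `O`, the form of the tameness hypotheses of the Final State Conjecture
routes). [cite: Petersen2006, Ch. 10 §3.1] -/
theorem exists_strictMono_tendsto_supCkENorm_sub_of_supCkENorm_le {O : Set E} (hO : IsOpen O)
    {k : ℕ} {G : ℕ → E → W} (hG : ∀ n, ContDiffOn ℝ (k + 1) (G n) O) {Λ : ℝ≥0∞} (hΛ : Λ ≠ ⊤)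
    (hGΛ : ∀ n, supCkENorm O (k + 1) (G n) ≤ Λ) :
    ∃ (Glim : E → W) (φ : ℕ → ℕ), StrictMono φ ∧ ContDiffOn ℝ k Glim O ∧
      ∀ K ⊆ O, IsCompact K →
        Tendsto (fun n ↦ supCkENorm K k (G (φ n) - Glim)) atTop (𝓝 0) := by
  refine exists_strictMono_tendsto_supCkENorm_sub_of_bound hO hG (Λ := Λ.toReal)
    fun n i hi z hz ↦ ?_
  have hfin : supCkENorm O (k + 1) (G n) ≠ ⊤ := ne_top_of_le_ne_top hΛ (hGΛ n)
  exact (norm_iteratedFDeriv_le_toReal_supCkENorm hi hz (G n) hfin).trans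
    (ENNReal.toReal_mono hΛ (hGΛ n))

/-! ### Metric components of charts of a sequence of spacetimes -/

universe u in
/-- **Chart-wise `Cᵏ` compactness of uniformly tame spacetimes.** Let `𝓢ₙ` be spacetimes with
chart maps `ψₙ : E4 → 𝓢ₙ`, `C^∞` on a common open set `O ⊆ E4`, whose metric components
`metricInCoords ψₙ` have `C^{k+1}` sup norm `≤ Λ < ∞` on `O` (uniform tameness of the charts).
Then along a subsequence the metric components converge in `Cᵏ` on every compact subset of `O` to
a field of bilinear forms of class `Cᵏ` on `O` — the limit metric components (of a limit that is
in general only `Cᵏ`; gluing such chart limits into a limit spacetime is a separate matter).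
[cite: Petersen2006, Ch. 10 §3.1] -/
theorem Spacetime.exists_strictMono_tendsto_supCkENorm_metricInCoords_sub
    {𝓢ₙ : ℕ → Spacetime.{u} 4} {ψ : ∀ n, E4 → (𝓢ₙ n).carrier} {O : Set E4} (hO : IsOpen O)
    (hψ : ∀ n, ContMDiffOn 𝓘(ℝ, E4) (𝓡 4) ∞ (ψ n) O) {k : ℕ} {Λ : ℝ≥0∞} (hΛ : Λ ≠ ⊤)
    (hGΛ : ∀ n, supCkENorm O (k + 1) ((𝓢ₙ n).metricInCoords (ψ n)) ≤ Λ) :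
    ∃ (G : E4 → E4 →L[ℝ] E4 →L[ℝ] ℝ) (φ : ℕ → ℕ), StrictMono φ ∧ ContDiffOn ℝ k G O ∧
      ∀ K ⊆ O, IsCompact K →
        Tendsto (fun n ↦ supCkENorm K k ((𝓢ₙ (φ n)).metricInCoords (ψ (φ n)) - G)) atTop
          (𝓝 0) :=
  exists_strictMono_tendsto_supCkENorm_sub_of_supCkENorm_le hO
    (G := fun n ↦ (𝓢ₙ n).metricInCoords (ψ n))
    (fun n ↦ ((𝓢ₙ n).contDiffOn_metricInCoords hO (hψ n)).of_le (by exact_mod_cast le_top)) hΛ hGΛ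

end Literature.Geometry.Lorentzian
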